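import Summits.BirchSwinnertonDyer.BirchSwinnertonDyer.Theorems.ThetaPartnerAtTwoSignedControlAtTwoPlusLayerTwoField
import Summits.BirchSwinnertonDyer.Rank1Residual.Additive.KobayashiLayerLogDescent
import Summits.BirchSwinnertonDyer.Rank1Residual.Additive.KobayashiSignedGenerationDischarge
import HarnessLib

/-!
# The `ℤ₂`-LAYERS AT `2`, IV: LOGARITHMS on the plus layers — logs of layer points lie in the plus field, LOG DESCENT
# (`Λ P ∈ ℚ₂(u_{m+2}) ⟹ P ∈ E(ℚ_{2,m}·ℚ₂)`), LOCAL SURJECTIVITY onto the plus field, the CLOSURE CORRESPONDENCE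
# `ℤ[Γ·w] ≡ Λ(ℤ[Γ·g])`, and the PLUS GENERATION STEP of HONDA⁺@2 modulo the two analytic inputs «Prop. 8.11⁺ at 2» and
# the tower lemma `(T_n)` (K4 `SignedControlAtTwo`, stmt-BirchSwinnertonDyer-20309, line `eulerchar` v6, stub `stub_plusHondaSystemTwo`)

Route `ThetaPartnerAtTwo` (TP2; crux shared with `ResidualThetaTransportAtTwo`), crux K4, line `eulerchar` v6 (lead
`prover-bsd-wall-tp2-p3` g2); seat `prover-bsd-wall-tp2-p3-w2` (width seat 2/3, g2). Sequel of `…PlusLayerTwo` /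
`…PlusLayerTwoPoints` / `…PlusLayerTwoField` (parts I–III: the layer subgroups, layer points, layer traces and plus fields of the
cyclotomic `ℤ₂`-extension at the model `ℚ_[2]`).

SETTING (the O10 local series' currency, as in `KobayashiSignedGenerationDischarge` and the K3 lead's `…SignedKatoUpToAtTwoLocal*`):
`M/ℤ₂` a Weierstrass model with `(M ⊗ ℚ₂) ⊗ ℚ̄₂ = W ⊗ ℚ̄₂` (`hV : genFibΩ 2 M = W.baseChange (AlgebraicClosure ℚ_[2])`,
`toLoc hV : (genFibΩ 2 M)-points ≃+ localPoints W ℚ_[2]`), `L(k)` = points with coordinates in `layer 2 k = ℚ₂(ζ_{2^k})`,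
`E₁` = the kernel of reduction, `Λ = ptLogΩ 2 M` the `ℚ̄₂`-valued logarithm, `κ : ZpExtension ℚ 2` cyclotomic, `ι : ℚ̄ → ℚ̄₂` any,
`u_m = zeta 2 m + (zeta 2 m)⁻¹`, `v_n = u_{n+2} − 2`, plus field `k_n = ℚ_[2]⟮u_{n+2}⟯` (= `ℚ_{2,n}·ℚ₂`, part III), layer-`n`
points `localLayerPointsOfEmb κ ι W n = E(k_n)` (parts I–II).

WHAT (THEOREMS ONLY):
* §10 (D0) `ptLogΩ_mem_adjoin_u` — `P ∈ E₁`, `toLoc P ∈ E(k_n) ⟹ Λ P ∈ k_n` (equivariance `Λ(τP) = τΛ(P)` + part III).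
  (D1) **`toLoc_mem_localLayerPointsOfEmb_of_ptLogΩ_mem`** — LOG DESCENT: `P ∈ L(n+2) ∩ E₁`, `Λ P ∈ k_m` (`m ≤ n`) ⟹
  `toLoc P ∈ E(k_m)`, given no `2`-power torsion in `L(n+2)` (Kobayashi Prop. 8.7 at 2, the K3 lead's
  `eq_zero_of_two_pow_smul_eq_zero_of_mem_subfieldPoints_layer`, kept as the hypothesis `htors` here: route-free).
  (D2) **`exists_ptLogΩ_eq_of_mem_adjoin_u`** — LOCAL SURJECTIVITY onto the plus field: every `y ∈ k_n` with `‖y‖ ≤ 1/4` is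
  `Λ R` for some `R ∈ L(n+2) ∩ E₁` with `toLoc R ∈ E(k_n)`.
* §11 (D3) **`exists_closure_pt_of_sub_mem`** — CLOSURE CORRESPONDENCE (plus twin of O10's `exists_closure_pt`): for a Galois-stable
  intermediate field `F` (e.g. `k_{n−1}`), `g ∈ L(k) ∩ E₁` with `Λ g − w ∈ F`: every `z ∈ ℤ[Γ·w]` is `Λ B` modulo `F` for some
  `B ∈ ℤ[Γ·g] ⊆ L(k) ∩ E₁` (abstract coordinatewise action `act`, as in the O10 files).
* §12 (D4) **`exists_sub_closure_sub_two_smul_mem_plus`** — the PLUS GENERATION STEP modulo two analytic inputs: ASSUME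
  (i) `hdec` («`(T_n)` in decomposition form»: `𝒪_{k_n} ⊆ ℤ[Γ·v_n] + 8𝒪_{k_n} + k_{n−1}`, i.e. every `y ∈ k_n`, `‖y‖ ≤ 1` is
  `z + 8y' + ν` with `z ∈ ℤ[Γ·v_n]`, `y' ∈ k_n`, `‖y'‖ ≤ 1`, `ν ∈ k_{n−1}`) and (ii) `h811` («Prop. 8.11⁺ at 2» in O10 file-31 form:
  `Λ(E₁(k_n)) ⊆ k_{n−1} + 𝒪_{k_n}`), and a generator `g ∈ E₁(k_n)` with `Λ g ≡ v_n (mod k_{n−1})`; THEN every `P ∈ E₁(k_n)` is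
  `B + P' + 2•R` with `B ∈ ℤ[Γ_{ℚ₂}]·(toLoc g)`, `P' ∈ E(k_{n−1})`, `R ∈ E(k_n)` — the (GEN) clause of `stub_plusHondaSystemTwo` at
  level `n` on `E₁`, in the stub's own currency (`AddSubgroup.closure (Set.range fun σ ↦ σ • toLoc g)`, `localLayerPointsOfEmb`).
  (D5) `plusGen_of_plusGen_kernel_of_odd_nsmul` — the passage from `E₁(k_n)` to `E(k_n)` given an odd multiple in `E₁`
  (`#Ẽ(𝔽₂)` odd at a supersingular `2`; the multiple is a hypothesis here).

HONEST FRAMING: THEOREMS ONLY (no definition, no named fact, no instance, no `sorry`), route-independent (no `Theses`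
import); the two analytic inputs (i), (ii) of the lead's memo LAGPLUS-AT-2-CONSTRUCTION §4 (iii), (v) and the torsion / saturation
facts are HYPOTHESES of the theorems here, not claims; closes no item; BSD is not proved by any of this.

References: [Kobayashi2003] S. Kobayashi, Invent. Math. 152 (2003), §8.4 (Prop. 8.7, Lemma 8.9, Prop. 8.11, Prop. 8.12);
[SilvermanAEC2009] IV.6.4 (formal logarithm), VII.2.2; [Washington1997] §13.1.
-/

set_option autoImplicit false
-- the Theorems namespace of this sub repeats the summit name by design (D-0017 nested layout)
set_option linter.dupNamespace false

noncomputable section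

open scoped Classical IntermediateField Topology NNReal

namespace Summit.BirchSwinnertonDyer.BirchSwinnertonDyer.Theorems.SignedEC.PlusLayer

open Field WeierstrassCurve Literature.NumberTheory.EllipticCurves Literature.NumberTheory.GaloisRepresentations
  Literature.NumberTheory.EllipticCurves.ZpExtension Literature.NumberTheory.EllipticCurves.Kobayashi2003
  Literature.NumberTheory.EllipticCurves.FormalGroupChart
  Summit.BirchSwinnertonDyer.Rank1Residual.Additive Summit.BirchSwinnertonDyer.Rank1Residual.Additive.PadicCyclotomicTower
  Summit.BirchSwinnertonDyer.Rank1Residual.Additive.BallEval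

variable {M : WeierstrassCurve ℤ_[2]} [hE : (M.map PadicInt.Coe.ringHom).IsElliptic]
  [hintΩ : (genFibΩ 2 M).IsIntegral (Valued.v (R := PadicAlgCl 2)).integer]
  {W : WeierstrassCurve ℚ} (hV : genFibΩ 2 M = W.baseChange (AlgebraicClosure ℚ_[2]))
  {κ : ZpExtension ℚ 2} (ι : AlgebraicClosure ℚ →ₐ[ℚ] PadicAlgCl 2)

/-! ## §10 Logarithms of plus-layer points: (D0) values in the plus field, (D1) log descent, (D2) local surjectivity -/

section LogDescent

omit hE hintΩ in
/-- The transported Galois action on `E_Ω`-points through `toLoc`, as a function (the `act` of the O10 files), fixes `O`.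
[folklore] -/
theorem act_toLoc_zero (σ : absoluteGaloisGroup ℚ_[2]) : (toLoc hV).symm (σ • toLoc hV 0) = 0 := act_zero hV σ

omit hE hintΩ in
/-- (D0) **`Λ P ∈ k_n` for `P ∈ E₁` with `toLoc P ∈ E(k_n)`**: `Λ(τ•P) = τ•Λ(P)` for every `τ ∈ Γ_{ℚ₂}` (`ptLogΩ_act`), `P` is fixed
by `Gal(ℚ̄₂/ℚ_{2,n})`, and `k_n = ℚ₂(u_{n+2})` is the fixed field of that group (part III). [cite: Kobayashi2003, §8.4] -/
theorem ptLogΩ_mem_adjoin_u [hintΩ' : (genFibΩ 2 M).IsIntegral (Valued.v (R := PadicAlgCl 2)).integer]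
    (hκ : κ.IsCyclotomic) {n : ℕ} {P : (genFibΩ 2 M).toAffine.Point}
    (hk : P ∈ kernel (Valued.v (R := PadicAlgCl 2)) (genFibΩ 2 M)) (hP : toLoc hV P ∈ localLayerPointsOfEmb κ ι W n) :
    ptLogΩ 2 M P ∈ ℚ_[2]⟮zeta 2 (n + 2) + (zeta 2 (n + 2))⁻¹⟯ := by
  rw [mem_adjoin_u_iff_forall_mem_localLayerSubgroupOfEmb ι hκ n]
  intro τ hτ
  have hfix : τ • toLoc hV P = toLoc hV P := (mem_localLayerPointsOfEmb_iff κ ι W n _).mp hP τ hτ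
  have h := ptLogΩ_act (fun σ Q ↦ (toLoc hV).symm (σ • toLoc hV Q)) (act_zero hV) (act_some hV) τ
    (norm_zCoord_lt_one_of_mem_kernel hk)
  rw [hfix, AddEquiv.symm_apply_apply] at h
  exact h.symm

/-- (D1) **LOG DESCENT to a plus layer**: for `P ∈ L(n+2) ∩ E₁` (coordinates in `ℚ₂(ζ_{2^{n+2}})`, in the kernel of reduction)
whose logarithm lies in the plus field `k_m = ℚ₂(u_{m+2})` (any `m`; in practice `m ≤ n`), the local point `toLoc P` lies in `E(k_m) =
localLayerPointsOfEmb κ ι W m` — provided `L(n+2)` has no `2`-power torsion (`htors`, Kobayashi's Prop. 8.7 at `2`). Proof: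
`Λ P ∈ ℚ₂(ζ_{2^{m+2}})` gives coordinates in that layer (`mem_subfieldPoints_of_ptLogΩ_mem`), and `σ₀Λ P = Λ P` for an inverter
`σ₀` of `ζ_{2^{m+2}}` gives `σ₀P = P` (`act_eq_zsmul_of_smul_ptLogΩ_eq`); part II's `mem_localLayerPointsOfEmb_two_iff_stab`.
[cite: Kobayashi2003, §8.4 (Prop. 8.7, Prop. 8.11)] -/
theorem toLoc_mem_localLayerPointsOfEmb_of_ptLogΩ_mem (hκ : κ.IsCyclotomic) {n m : ℕ}
    (htors : ∀ Q ∈ subfieldPoints (genFibΩ 2 M) (layer 2 (n + 2)).toSubfield coeffs_mem_layer,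
      ∀ k : ℕ, 2 ^ k • Q = 0 → Q = 0)
    {P : (genFibΩ 2 M).toAffine.Point}
    (hPL : P ∈ subfieldPoints (genFibΩ 2 M) (layer 2 (n + 2)).toSubfield coeffs_mem_layer)
    (hPk : P ∈ kernel (Valued.v (R := PadicAlgCl 2)) (genFibΩ 2 M))
    (hΛ : ptLogΩ 2 M P ∈ ℚ_[2]⟮zeta 2 (m + 2) + (zeta 2 (m + 2))⁻¹⟯) :
    toLoc hV P ∈ localLayerPointsOfEmb κ ι W m := by
  obtain ⟨σ₀, -, hσ₀⟩ := exists_inverter_mem_localLayerSubgroupOfEmb_two ι hκ m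
  obtain ⟨hΛlayer, hΛfix⟩ := (mem_adjoin_u_iff_mem_layer_and_smul_eq hσ₀ _).mp hΛ
  set act : absoluteGaloisGroup ℚ_[2] → (genFibΩ 2 M).toAffine.Point → (genFibΩ 2 M).toAffine.Point :=
    fun σ Q ↦ (toLoc hV).symm (σ • toLoc hV Q) with hact
  -- coordinates in `ℚ₂(ζ_{2^{m+2}})`
  have hPm : P ∈ subfieldPoints (genFibΩ 2 M) (layer 2 (m + 2)).toSubfield coeffs_mem_layer :=
    mem_subfieldPoints_of_ptLogΩ_mem act (act_zero hV) (act_some hV) htors hPL hPk hΛlayer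
  rw [mem_localLayerPointsOfEmb_two_iff_stab W ι hκ hσ₀]
  refine ⟨(forall_smul_eq_iff_mem_subfieldPoints hV (m + 2) (toLoc hV P)).mpr
    (by rw [AddEquiv.symm_apply_apply]; exact hPm), ?_⟩
  -- `σ₀ P = P` from `σ₀ Λ P = Λ P`
  have h1 : act σ₀ P = (1 : ℤ) • P :=
    act_eq_zsmul_of_smul_ptLogΩ_eq act (act_zero hV) (act_some hV) htors hPL hPk σ₀ 1 (by rw [one_zsmul]; exact hΛfix)
  rw [one_zsmul, hact] at h1
  have h2 := congrArg (toLoc hV) h1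
  rwa [AddEquiv.apply_symm_apply] at h2

/-- (D2) **LOCAL SURJECTIVITY onto the plus field**: every `y ∈ k_n = ℚ₂(u_{n+2})` with `‖y‖ ≤ 1/4` is the logarithm of a point
`R ∈ L(n+2) ∩ E₁` with `toLoc R ∈ E(k_n)` (O10 `exists_mem_kernel_ptLogΩ_eq` on `ℚ₂(ζ_{2^{n+2}}) ⊇ k_n`, then (D1) with `m = n`).
[cite: SilvermanAEC2009, IV.6.4] [cite: Kobayashi2003, §8.4] -/
theorem exists_ptLogΩ_eq_of_mem_adjoin_u (hκ : κ.IsCyclotomic) {n : ℕ}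
    (htors : ∀ Q ∈ subfieldPoints (genFibΩ 2 M) (layer 2 (n + 2)).toSubfield coeffs_mem_layer,
      ∀ k : ℕ, 2 ^ k • Q = 0 → Q = 0)
    {y : PadicAlgCl 2} (hy : y ∈ ℚ_[2]⟮zeta 2 (n + 2) + (zeta 2 (n + 2))⁻¹⟯) (hy4 : ‖y‖ ≤ 1 / 4) :
    ∃ R ∈ subfieldPoints (genFibΩ 2 M) (layer 2 (n + 2)).toSubfield coeffs_mem_layer,
      R ∈ kernel (Valued.v (R := PadicAlgCl 2)) (genFibΩ 2 M) ∧ ptLogΩ 2 M R = y ∧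
        toLoc hV R ∈ localLayerPointsOfEmb κ ι W n := by
  obtain ⟨R, hRL, hRk, hRy⟩ := exists_mem_kernel_ptLogΩ_eq (M := M) (adjoin_u_le_layer (n + 2) hy) hy4
  exact ⟨R, hRL, hRk, hRy, toLoc_mem_localLayerPointsOfEmb_of_ptLogΩ_mem hV ι hκ htors hRL hRk (hRy ▸ hy)⟩

end LogDescent

/-! ## §11 (D3) The closure correspondence `ℤ[Γ·w] ≡ Λ(ℤ[Γ·g])` modulo a Galois-stable subfield -/

section Closure

/-- (D3) **CLOSURE CORRESPONDENCE** (plus twin of O10's `KobayashiTowerGeneration.exists_closure_pt`, abstract coordinatewise action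
`act`): let `F` be a Galois-STABLE intermediate field of `ℚ̄₂/ℚ₂` (e.g. `k_{n−1} = ℚ₂(u_{n+1})`, part III `apply_mem_adjoin_u`),
`g ∈ L(k) ∩ E₁` with `Λ g − w ∈ F`. Then every `z` in the subgroup `ℤ[Γ·w]` generated by the `Γ_{ℚ₂}`-orbit of `w` is `Λ B`
modulo `F` for some `B` in the subgroup generated by the `Γ_{ℚ₂}`-orbit of `g`, with `B ∈ L(k) ∩ E₁`. [cite: Kobayashi2003, Prop. 8.11] -/
theorem exists_closure_pt_of_sub_mem
    (act : absoluteGaloisGroup ℚ_[2] → (genFibΩ 2 M).toAffine.Point → (genFibΩ 2 M).toAffine.Point)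
    (hact0 : ∀ σ, act σ 0 = 0)
    (hact : ∀ σ (x y : PadicAlgCl 2) (h : (genFibΩ 2 M).toAffine.Nonsingular x y),
      ∃ h', act σ (Affine.Point.some x y h) = Affine.Point.some (σ • x) (σ • y) h')
    (F : IntermediateField ℚ_[2] (PadicAlgCl 2)) (hF : ∀ (σ : absoluteGaloisGroup ℚ_[2]) (x : PadicAlgCl 2), x ∈ F → σ • x ∈ F)
    {k : ℕ} {g : (genFibΩ 2 M).toAffine.Point}
    (hgL : g ∈ subfieldPoints (genFibΩ 2 M) (layer 2 k).toSubfield coeffs_mem_layer)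
    (hgk : g ∈ kernel (Valued.v (R := PadicAlgCl 2)) (genFibΩ 2 M)) {w : PadicAlgCl 2} (hgw : ptLogΩ 2 M g - w ∈ F)
    {z : PadicAlgCl 2} (hz : z ∈ AddSubgroup.closure (Set.range fun σ : absoluteGaloisGroup ℚ_[2] ↦ σ • w)) :
    ∃ B ∈ AddSubgroup.closure (Set.range fun σ : absoluteGaloisGroup ℚ_[2] ↦ act σ g),
      B ∈ subfieldPoints (genFibΩ 2 M) (layer 2 k).toSubfield coeffs_mem_layer ∧
      B ∈ kernel (Valued.v (R := PadicAlgCl 2)) (genFibΩ 2 M) ∧ ptLogΩ 2 M B - z ∈ F := by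
  haveI := isIntegral_curveK 2 (LayerField 2 k) M
  have hgz : ‖g.zCoord‖ < 1 := norm_zCoord_lt_one_of_mem_kernel hgk
  induction hz using AddSubgroup.closure_induction with
  | mem x hx =>
    obtain ⟨σ, rfl⟩ := hx
    refine ⟨act σ g, AddSubgroup.subset_closure ⟨σ, rfl⟩, act_mem_subfieldPoints act hact0 hact σ hgL,
      act_mem_kernel act hact0 hact σ hgk, ?_⟩
    rw [ptLogΩ_act act hact0 hact σ hgz]
    change σ • ptLogΩ 2 M g - σ • w ∈ F
    rw [← smul_sub]
    exact hF σ _ hgw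
  | zero =>
    refine ⟨0, AddSubgroup.zero_mem _, (subfieldPoints _ _ _).zero_mem,
      (kernel (Valued.v (R := PadicAlgCl 2)) (genFibΩ 2 M)).zero_mem, ?_⟩
    rw [ptLogΩ_zero, sub_zero]; exact IntermediateField.zero_mem _
  | add x y _ _ ihx ihy =>
    obtain ⟨B₁, hB₁, hB₁L, hB₁k, h₁⟩ := ihx
    obtain ⟨B₂, hB₂, hB₂L, hB₂k, h₂⟩ := ihy
    refine ⟨B₁ + B₂, AddSubgroup.add_mem _ hB₁ hB₂, (subfieldPoints _ _ _).add_mem hB₁L hB₂L,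
      (kernel (Valued.v (R := PadicAlgCl 2)) (genFibΩ 2 M)).add_mem hB₁k hB₂k, ?_⟩
    rw [ptLogΩ_add (m := k) hB₁L hB₂L hB₁k hB₂k]
    have e : ptLogΩ 2 M B₁ + ptLogΩ 2 M B₂ - (x + y) = (ptLogΩ 2 M B₁ - x) + (ptLogΩ 2 M B₂ - y) := by ring
    rw [e]; exact IntermediateField.add_mem _ h₁ h₂
  | neg x _ ih =>
    obtain ⟨B, hB, hBL, hBk, h⟩ := ih
    refine ⟨-B, AddSubgroup.neg_mem _ hB, (subfieldPoints _ _ _).neg_mem hBL,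
      (kernel (Valued.v (R := PadicAlgCl 2)) (genFibΩ 2 M)).neg_mem hBk, ?_⟩
    have hneg : ptLogΩ 2 M (-B) = -ptLogΩ 2 M B := by
      have h0 := ptLogΩ_sub (m := k) (subfieldPoints _ _ _).zero_mem hBL
        (kernel (Valued.v (R := PadicAlgCl 2)) (genFibΩ 2 M)).zero_mem hBk
      rw [zero_sub, ptLogΩ_zero, zero_sub] at h0
      exact h0
    rw [hneg]
    have e : -ptLogΩ 2 M B - -x = -(ptLogΩ 2 M B - x) := by ring
    rw [e]; exact IntermediateField.neg_mem _ h

end Closure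

/-! ## §12 (D4) The plus generation step modulo «Prop. 8.11⁺ at 2» and the tower lemma `(T_n)`; (D5) odd saturation -/

section GenStep

omit hE hintΩ in
/-- The closure of the `Γ`-orbit of `toLoc g` in `localPoints` is the `toLoc`-image of the closure of the `act`-orbit of `g`.
[folklore] -/
theorem map_closure_range_act_eq (g : (genFibΩ 2 M).toAffine.Point) :
    (AddSubgroup.closure (Set.range fun σ : absoluteGaloisGroup ℚ_[2] ↦ (toLoc hV).symm (σ • toLoc hV g))).map
        (toLoc hV).toAddMonoidHom =
      AddSubgroup.closure (Set.range fun σ : absoluteGaloisGroup ℚ_[2] ↦ σ • toLoc hV g) := by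
  rw [AddMonoidHom.map_closure]
  congr 1
  ext P
  constructor
  · rintro ⟨_, ⟨σ, rfl⟩, rfl⟩
    exact ⟨σ, ((toLoc hV).apply_symm_apply _).symm⟩
  · rintro ⟨σ, rfl⟩
    exact ⟨_, ⟨σ, rfl⟩, (toLoc hV).apply_symm_apply _⟩

/-- (D4) **The PLUS GENERATION STEP modulo the two analytic inputs** (plus twin of O10's `exists_sub_closure_sub_smul_mem`, level `n`):
ASSUME (i) `hdec` — the tower lemma `(T_n)` in decomposition form `𝒪_{k_n} ⊆ ℤ[Γ·v_n] + 8𝒪_{k_n} + k_{n−1}`; (ii) `h811` — «Prop. 8.11⁺ at 2»: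
`Λ(E₁(k_n)) ⊆ k_{n−1} + 𝒪_{k_n}`; (iii) no `2`-power torsion in `L(n+2)`; and a generator `g ∈ L(n+2) ∩ E₁` with `toLoc g ∈ E(k_n)` and
`Λ g ≡ v_n (mod k_{n−1})`. THEN every `P ∈ L(n+2) ∩ E₁` with `toLoc P ∈ E(k_n)` satisfies the (GEN) clause of `stub_plusHondaSystemTwo` at
level `n`: `toLoc P = B + P' + 2•R` with `B ∈ ℤ[Γ_{ℚ₂}]·toLoc g`, `P' ∈ E(k_{n−1})`, `R ∈ E(k_n)`. Proof as in Kobayashi Prop. 8.11 ⇒ 8.12: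
`Λ P = μ₀ + y` (ii), `y = z + 8y' + ν` (i), `8y' = Λ(2R)` ((D2) with `4y'`), `z ≡ Λ B` ((D3)), so `Λ(P − B − 2R) ∈ k_{n−1}` and (D1).
[cite: Kobayashi2003, Prop. 8.11, Prop. 8.12] -/
theorem exists_sub_closure_sub_two_smul_mem_plus (hκ : κ.IsCyclotomic) {n : ℕ}
    (htors : ∀ Q ∈ subfieldPoints (genFibΩ 2 M) (layer 2 (n + 2)).toSubfield coeffs_mem_layer,
      ∀ k : ℕ, 2 ^ k • Q = 0 → Q = 0)
    (hdec : ∀ y ∈ ℚ_[2]⟮zeta 2 (n + 2) + (zeta 2 (n + 2))⁻¹⟯, ‖y‖ ≤ 1 →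
      ∃ z ∈ AddSubgroup.closure (Set.range fun σ : absoluteGaloisGroup ℚ_[2] ↦ σ • (zeta 2 (n + 2) + (zeta 2 (n + 2))⁻¹ - 2)),
        ∃ y' ∈ ℚ_[2]⟮zeta 2 (n + 2) + (zeta 2 (n + 2))⁻¹⟯, ‖y'‖ ≤ 1 ∧
          y - z - 8 * y' ∈ ℚ_[2]⟮zeta 2 (n + 1) + (zeta 2 (n + 1))⁻¹⟯)
    (h811 : ∀ P ∈ subfieldPoints (genFibΩ 2 M) (layer 2 (n + 2)).toSubfield coeffs_mem_layer,
      P ∈ kernel (Valued.v (R := PadicAlgCl 2)) (genFibΩ 2 M) → toLoc hV P ∈ localLayerPointsOfEmb κ ι W n →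
        ∃ μ₀ ∈ ℚ_[2]⟮zeta 2 (n + 1) + (zeta 2 (n + 1))⁻¹⟯, ∃ y ∈ ℚ_[2]⟮zeta 2 (n + 2) + (zeta 2 (n + 2))⁻¹⟯,
          ‖y‖ ≤ 1 ∧ ptLogΩ 2 M P = μ₀ + y)
    {g : (genFibΩ 2 M).toAffine.Point}
    (hgL : g ∈ subfieldPoints (genFibΩ 2 M) (layer 2 (n + 2)).toSubfield coeffs_mem_layer)
    (hgk : g ∈ kernel (Valued.v (R := PadicAlgCl 2)) (genFibΩ 2 M))
    (hgv : ptLogΩ 2 M g - (zeta 2 (n + 2) + (zeta 2 (n + 2))⁻¹ - 2) ∈ ℚ_[2]⟮zeta 2 (n + 1) + (zeta 2 (n + 1))⁻¹⟯)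
    {P : (genFibΩ 2 M).toAffine.Point}
    (hPL : P ∈ subfieldPoints (genFibΩ 2 M) (layer 2 (n + 2)).toSubfield coeffs_mem_layer)
    (hPk : P ∈ kernel (Valued.v (R := PadicAlgCl 2)) (genFibΩ 2 M)) (hPn : toLoc hV P ∈ localLayerPointsOfEmb κ ι W n) :
    ∃ B ∈ AddSubgroup.closure (Set.range fun σ : absoluteGaloisGroup ℚ_[2] ↦ σ • toLoc hV g),
      ∃ P' ∈ localLayerPointsOfEmb κ ι W (n - 1), ∃ R ∈ localLayerPointsOfEmb κ ι W n,
        toLoc hV P = B + P' + 2 • R := by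
  haveI := isIntegral_curveK 2 (LayerField 2 (n + 2)) M
  set act : absoluteGaloisGroup ℚ_[2] → (genFibΩ 2 M).toAffine.Point → (genFibΩ 2 M).toAffine.Point :=
    fun σ Q ↦ (toLoc hV).symm (σ • toLoc hV Q) with hact
  set L := subfieldPoints (genFibΩ 2 M) (layer 2 (n + 2)).toSubfield coeffs_mem_layer with hLdef
  set E₁ := kernel (Valued.v (R := PadicAlgCl 2)) (genFibΩ 2 M) with hE₁def
  set Fn := ℚ_[2]⟮zeta 2 (n + 2) + (zeta 2 (n + 2))⁻¹⟯ with hFn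
  set Fn' := ℚ_[2]⟮zeta 2 (n + 1) + (zeta 2 (n + 1))⁻¹⟯ with hFn'
  -- (ii): `Λ P = μ₀ + y`
  obtain ⟨μ₀, hμ₀, y, hy, hy1, hΛP⟩ := h811 P hPL hPk hPn
  -- (i): `y = z + 8 y' + ν`
  obtain ⟨z, hz, y', hy', hy'1, hν⟩ := hdec y hy hy1
  -- local surjectivity: `4 y' = Λ R`, `R ∈ E₁(k_n)`, so `8 y' = Λ (2 • R)`
  have h4 : ‖(4 : PadicAlgCl 2) * y'‖ ≤ 1 / 4 := by
    have h2n : ‖(2 : PadicAlgCl 2)‖ = 2⁻¹ := by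
      have h := (PadicAlgCl.norm_extends (p := 2) ((2 : ℕ) : ℚ_[2])).trans Padic.norm_p
      rw [map_natCast] at h
      exact_mod_cast h
    have h4n : ‖(4 : PadicAlgCl 2)‖ = 4⁻¹ := by
      rw [show (4 : PadicAlgCl 2) = 2 ^ 2 by norm_num, norm_pow, h2n]; norm_num
    rw [norm_mul, h4n]
    calc (4 : ℝ)⁻¹ * ‖y'‖ ≤ 4⁻¹ * 1 := by gcongr
      _ = 1 / 4 := by norm_num
  obtain ⟨R, hRL, hRk, hRy, hRn⟩ := exists_ptLogΩ_eq_of_mem_adjoin_u hV ι hκ htors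
    (Subalgebra.mul_mem _ (by exact_mod_cast IntermediateField.natCast_mem Fn 4) hy') h4
  -- (D3): `z ≡ Λ B (mod k_{n−1})`
  obtain ⟨B, hB, hBL, hBk, hBz⟩ := exists_closure_pt_of_sub_mem act (act_zero hV) (act_some hV) Fn'
    (fun σ x hx ↦ by rw [absoluteGaloisGroup.smul_def]; exact apply_mem_adjoin_u _ hx) hgL hgk hgv hz
  -- the candidate: `P − B − 2 • R`
  have h2RL : (2 : ℕ) • R ∈ L := L.nsmul_mem hRL 2
  have h2Rk : (2 : ℕ) • R ∈ E₁ := E₁.nsmul_mem hRk 2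
  have hDL : P - B - (2 : ℕ) • R ∈ L := L.sub_mem (L.sub_mem hPL hBL) h2RL
  have hDk : P - B - (2 : ℕ) • R ∈ E₁ := E₁.sub_mem (E₁.sub_mem hPk hBk) h2Rk
  have hΛ2R : ptLogΩ 2 M ((2 : ℕ) • R) = 8 * y' := by
    rw [ptLogΩ_nsmul hRL hRk, hRy]; push_cast; ring
  have hΛD : ptLogΩ 2 M (P - B - (2 : ℕ) • R) ∈ Fn' := by
    rw [ptLogΩ_sub (m := n + 2) (L.sub_mem hPL hBL) h2RL (E₁.sub_mem hPk hBk) h2Rk,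
      ptLogΩ_sub (m := n + 2) hPL hBL hPk hBk, hΛP, hΛ2R]
    have e : μ₀ + y - ptLogΩ 2 M B - 8 * y' = μ₀ + (y - z - 8 * y') - (ptLogΩ 2 M B - z) := by ring
    rw [e]
    exact IntermediateField.sub_mem _ (IntermediateField.add_mem _ hμ₀ hν) hBz
  -- log descent to level `n − 1`
  have hdesc : toLoc hV (P - B - (2 : ℕ) • R) ∈ localLayerPointsOfEmb κ ι W (n - 1) := by
    rcases Nat.eq_zero_or_pos n with rfl | hn
    · -- `n = 0`: `k_{−1}`-target is `E(ℚ₂) = E(k_0)`; `Fn' = ℚ₂(u_1) = ℚ₂ ≤ k_0`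
      have hΛ0 : ptLogΩ 2 M (P - B - (2 : ℕ) • R) ∈ ℚ_[2]⟮zeta 2 (0 + 2) + (zeta 2 (0 + 2))⁻¹⟯ := by
        have hbot : Fn' ≤ ℚ_[2]⟮zeta 2 (0 + 2) + (zeta 2 (0 + 2))⁻¹⟯ := by
          rw [hFn', show (0 + 1 : ℕ) = 1 from rfl, adjoin_u_one_eq_bot]; exact bot_le
        exact hbot hΛD
      simpa using toLoc_mem_localLayerPointsOfEmb_of_ptLogΩ_mem hV ι hκ htors hDL hDk hΛ0
    · obtain ⟨n', rfl⟩ := Nat.exists_eq_add_of_le' hn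
      rw [Nat.add_sub_cancel]
      exact toLoc_mem_localLayerPointsOfEmb_of_ptLogΩ_mem hV ι hκ htors hDL hDk
        (by simpa [hFn'] using hΛD)
  -- assemble in `localPoints`
  refine ⟨toLoc hV B, ?_, toLoc hV (P - B - (2 : ℕ) • R), hdesc, toLoc hV R, hRn, ?_⟩
  · rw [← map_closure_range_act_eq hV g]
    exact ⟨B, hB, rfl⟩
  · simp only [map_sub, map_nsmul]
    abel

/-- (D5) **Odd saturation**: if the (GEN) clause holds for `c • P` with `c` odd (`c • P ∈ toLoc(E₁)`: at a supersingular `2` the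
reduction has odd order, so an odd multiple of every point lies in the kernel of reduction), then it holds for `P`:
`P = c•P − (c−1)•P` and `c − 1` is even. [cite: Kobayashi2003, Prop. 8.12] -/
theorem plusGen_of_plusGen_odd_nsmul {A : Type*} [AddCommGroup A] {S : AddSubgroup A} {H H' : AddSubgroup A}
    {P : A} (hP : P ∈ H) {c : ℕ} (hc : Odd c)
    (h : ∃ B ∈ S, ∃ P' ∈ H', ∃ R ∈ H, c • P = B + P' + 2 • R) :
    ∃ B ∈ S, ∃ P' ∈ H', ∃ R ∈ H, P = B + P' + 2 • R := by
  obtain ⟨B, hB, P', hP', R, hR, hcP⟩ := h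
  obtain ⟨k, rfl⟩ := hc
  refine ⟨B, hB, P', hP', R - k • P, H.sub_mem hR (H.nsmul_mem hP k), ?_⟩
  calc P = (2 * k + 1) • P - 2 • (k • P) := by rw [add_nsmul, one_nsmul, mul_nsmul', add_sub_cancel_left]
    _ = B + P' + 2 • R - 2 • (k • P) := by rw [hcP]
    _ = B + P' + 2 • (R - k • P) := by rw [nsmul_sub]; abel

end GenStep

end Summit.BirchSwinnertonDyer.BirchSwinnertonDyer.Theorems.SignedEC.PlusLayer

end
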